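import Summits.AtomisticToContinuum.BoseEinsteinCondensation.Theses.BECConjugateDomination
import Literature.MathematicalPhysics.QuantumManyBody.PeriodizedPotentialNearestImage
import Literature.MathematicalPhysics.QuantumManyBody.PeriodicConfigLaplacian
import Literature.MathematicalPhysics.QuantumManyBody.PeriodicEnergyFirstVariation
import Literature.MathematicalPhysics.QuantumManyBody.PeriodicBoseGasImpurityTranslation

/-!
# Route `BECConjugateDomination`, crux `PuffFloor` (stmt-AtomisticToContinuum-11785),
# line `coupling-slope-pocket`, stub S4a: the Euler–Lagrange equation of a `C³` exact minimiser

Supports (does not close) stmt-AtomisticToContinuum-11785. The pointwise eigenvalue equation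
`-ΔΨ(X) + V(X)Ψ(X) = E₀Ψ(X)` (`ΔΨ = ∑ᵢ ∑ₐ ∂_{i,a}∂_{i,a}Ψ`, `V = ∑_{i<j} v^per(xᵢ - xⱼ)`,
`E₀ = periodicGroundStateEnergy v N L`, units `ħ = 2m = 1`) of an exact minimiser `Ψ ∈ C³` of the
periodic `N`-body energy in the `C¹` Bose-symmetric periodic class:

* `PuffFloorEulerLagrange.eulerLagrange_pointwise` — the general statement, for any potential whose
  periodic interaction is `ofReal` of a `C¹` real `V ≥ 0`: the first variation at the minimiser
  (`PeriodicTrialState.firstVariation_eq` of `Literature/…/PeriodicEnergyFirstVariation.lean`) tested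
  against the residual `r = -ΔΨ + VΨ - E₀Ψ` (admissible: `C¹`, periodic, Bose-symmetric, by the
  calculus of `Literature/…/PeriodicConfigLaplacian.lean`), Green's formula on the torus
  (`integral_cellN_sum_inner_fderiv_eq`) and du Bois-Reymond
  (`IsTorusPeriodic.eq_zero_of_lintegral_normSq_eq_zero`) give `∫|r|² = 0`, `r ≡ 0`;
* `stub_eulerLagrange` — the registered stub: for a finite `C²` finite-range profile on a torus of
  side `L > 2R₀` the periodic interaction is finite and `C²` (nearest image,
  `Literature/…/PeriodizedPotentialNearestImage.lean`).

References: M. Reed, B. Simon, *Methods of Modern Mathematical Physics IV* (1978), §XIII.12;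
E. H. Lieb, R. Seiringer, J. P. Solovej, J. Yngvason, *The Mathematics of the Bose Gas and its
Condensation* (2005), Ch. 2 (2.1); S. Fournais (2020), (1.1)–(1.2).
-/

noncomputable section

namespace Summit.AtomisticToContinuum.BoseEinsteinCondensation.Theorems

open MeasureTheory Filter
open scoped ENNReal NNReal BigOperators InnerProductSpace
open Literature.MathematicalPhysics.QuantumManyBody.BoseGas
open Summit.AtomisticToContinuum.BoseEinsteinCondensation.Theses.BECConjugateDomination

namespace PuffFloorEulerLagrange

variable {N : ℕ} {L : ℝ}

/-- The coordinate unit vector `e_{i,a}` of `(ℝ³)^N` (particle `i`, axis `a`), local notation. -/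
local notation3 "𝐞[" i ", " a "]" => (Pi.single i (EuclideanSpace.single a (1 : ℝ)) : Config _)

/-! ### The Euler–Lagrange equation for a general `C¹` potential -/

variable {v : ℝ → ℝ≥0∞} {V : Config N → ℝ}

/-- **Euler–Lagrange (eigenvalue) equation of a smooth exact minimiser, pointwise.** On the torus of
side `L > 0`, let the periodic interaction `∑_{i<j} v^per(xᵢ - xⱼ)` be `ofReal` of a `C¹` real
potential `V ≥ 0`, and let `Ψ` be an exact minimiser of the periodic `N`-body energy in the `C¹`
Bose-symmetric periodic class (`periodicEnergy v Ψ = E₀ = periodicGroundStateEnergy v N L < ∞`)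
with `Ψ ∈ C³`. Then `-ΔΨ(X) + V(X)Ψ(X) = E₀Ψ(X)` for every configuration `X`, with
`ΔΨ = ∑ᵢ ∑ₐ ∂_{i,a}∂_{i,a}Ψ` the coordinate Laplacian. Proof: the first variation
(`PeriodicTrialState.firstVariation_eq`) tested against the residual `r = -ΔΨ + VΨ - E₀Ψ` itself
(`C¹`, periodic and Bose-symmetric because `Ψ ∈ C³`, `V ∈ C¹` is periodic and symmetric), one
integration by parts on the torus (`integral_cellN_sum_inner_fderiv_eq`) giving `∫_{cell} |r|² = 0`,
and du Bois-Reymond (`IsTorusPeriodic.eq_zero_of_lintegral_normSq_eq_zero`). Sources: Reed–Simon IV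
§XIII.12 (eigenvalue equation of the variational ground state); LSSY2005 Ch. 2 (2.1); textbook
calculus of variations. -/
theorem eulerLagrange_pointwise (hL : 0 < L) (hV : ContDiff ℝ 1 V)
    (hV0 : ∀ X, 0 ≤ V X) (hW : ∀ X : Config N, periodicInteraction v L X = ENNReal.ofReal (V X))
    (Ψ : PeriodicTrialState N L) (hC3 : ContDiff ℝ 3 Ψ.ψ)
    (hmin : periodicEnergy v Ψ = periodicGroundStateEnergy v N L) (hfin : periodicEnergy v Ψ ≠ ⊤)
    (X : Config N) :
    -(∑ i : Fin N, ∑ a : Fin 3, fderiv ℝ (fun Y => fderiv ℝ Ψ.ψ Y 𝐞[i, a]) X 𝐞[i, a]) +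
        (V X : ℂ) * Ψ.ψ X = ((periodicGroundStateEnergy v N L).toReal : ℂ) * Ψ.ψ X := by
  set ψ := Ψ.ψ with hψdef
  set E : ℝ := (periodicGroundStateEnergy v N L).toReal with hEdef
  have hψ1 : ContDiff ℝ 1 ψ := Ψ.contDiff
  have hψ2 : ContDiff ℝ 2 ψ := hC3.of_le (by norm_num)
  have hψp : IsTorusPeriodic L ψ := Ψ.periodic
  -- the potential is periodic and symmetric, since the periodic interaction is
  have hVeq : ∀ Y, V Y = (periodicInteraction v L Y).toReal := fun Y => by
    rw [hW, ENNReal.toReal_ofReal (hV0 Y)]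
  have hVp : ∀ (Y : Config N) (j : Fin N) (l : Fin 3),
      V (Y + Pi.single j (EuclideanSpace.single l L)) = V Y := fun Y j l => by
    rw [hVeq, hVeq Y, periodicInteraction_add_single]
  have hVs : ∀ (σ : Equiv.Perm (Fin N)) (Y : Config N), V (Y ∘ σ) = V Y := fun σ Y => by
    rw [hVeq, hVeq Y, periodicInteraction_comp_perm]
  -- the Laplacian and the residual
  set D : Config N → ℂ := fun Y => ∑ i : Fin N, ∑ a : Fin 3,
    fderiv ℝ (fun Z => fderiv ℝ ψ Z 𝐞[i, a]) Y 𝐞[i, a] with hDdef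
  have hD1 : ContDiff ℝ 1 D := contDiff_configLaplacian_complex (n := 1) (hC3.of_le (by norm_num))
  have hDp : IsTorusPeriodic L D := hψp.configLaplacian_complex
  have hDs : ∀ (σ : Equiv.Perm (Fin N)) (Y : Config N), D (Y ∘ σ) = D Y := fun σ Y =>
    configLaplacian_complex_symm hψ2 Ψ.symm σ Y
  set r : Config N → ℂ := fun Y => -D Y + V Y • ψ Y - E • ψ Y with hrdef
  have hr1 : ContDiff ℝ 1 r := (hD1.neg.add (hV.smul hψ1)).sub (hψ1.const_smul E)
  have hrp : IsTorusPeriodic L r := fun Y j l => by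
    simp only [hrdef, hDp Y j l, hVp Y j l, hψp Y j l]
  have hrs : ∀ (σ : Equiv.Perm (Fin N)) (Y : Config N), r (Y ∘ σ) = r Y := fun σ Y => by
    simp only [hrdef, hDs σ Y, hVs σ Y, Ψ.symm σ Y, hψdef]
  -- the first variation tested against the residual, and Green's formula
  have hweak := Ψ.firstVariation_eq hV.continuous hV0 hW hmin hfin hr1 hrp hrs
  have hibp := integral_cellN_sum_inner_fderiv_eq hL hψ2 hr1 hψp hrp
  have hdc : ∀ {φ : Config N → ℂ}, ContDiff ℝ 1 φ → ∀ (i : Fin N) (a : Fin 3),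
      Continuous fun Y => fderiv ℝ φ Y 𝐞[i, a] := fun h i a =>
    (h.continuous_fderiv one_ne_zero).clm_apply continuous_const
  have hiK : IntegrableOn (fun Y => ∑ i : Fin N, ∑ a : Fin 3,
      ⟪fderiv ℝ ψ Y 𝐞[i, a], fderiv ℝ r Y 𝐞[i, a]⟫_ℝ) (cellN N L) volume :=
    integrableOn_cellN (continuous_finsetSum _ fun i _ => continuous_finsetSum _ fun a _ =>
      (hdc hψ1 i a).inner (𝕜 := ℝ) (hdc hr1 i a)) L
  have hiV : IntegrableOn (fun Y => V Y * ⟪ψ Y, r Y⟫_ℝ) (cellN N L) volume :=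
    integrableOn_cellN (hV.continuous.mul (hψ1.continuous.inner (𝕜 := ℝ) hr1.continuous)) L
  have hiD : IntegrableOn (fun Y => ⟪D Y, r Y⟫_ℝ) (cellN N L) volume :=
    integrableOn_cellN (hD1.continuous.inner (𝕜 := ℝ) hr1.continuous) L
  have hiP : IntegrableOn (fun Y => ⟪ψ Y, r Y⟫_ℝ) (cellN N L) volume :=
    integrableOn_cellN (hψ1.continuous.inner (𝕜 := ℝ) hr1.continuous) L
  -- `∫ |r|² = 0`
  have hrr : ∀ Y, ⟪r Y, r Y⟫_ℝ = -⟪D Y, r Y⟫_ℝ + V Y * ⟪ψ Y, r Y⟫_ℝ - E * ⟪ψ Y, r Y⟫_ℝ := by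
    intro Y
    conv_lhs => rw [show r Y = -D Y + V Y • ψ Y - E • ψ Y from rfl]
    rw [inner_sub_left, inner_add_left, inner_neg_left, real_inner_smul_left, real_inner_smul_left]
  have hibp' : ∫ Y in cellN N L, ∑ i : Fin N, ∑ a : Fin 3,
      ⟪fderiv ℝ ψ Y 𝐞[i, a], fderiv ℝ r Y 𝐞[i, a]⟫_ℝ = -∫ Y in cellN N L, ⟪D Y, r Y⟫_ℝ := hibp
  have hweak' : ∫ Y in cellN N L, (∑ i : Fin N, ∑ a : Fin 3,
      ⟪fderiv ℝ ψ Y 𝐞[i, a], fderiv ℝ r Y 𝐞[i, a]⟫_ℝ + V Y * ⟪ψ Y, r Y⟫_ℝ) =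
        E * ∫ Y in cellN N L, ⟪ψ Y, r Y⟫_ℝ := hweak
  have hkey : ∫ Y in cellN N L, ‖r Y‖ ^ 2 = 0 := by
    simp_rw [← real_inner_self_eq_norm_sq, hrr]
    have i1 : IntegrableOn (fun Y => -⟪D Y, r Y⟫_ℝ + V Y * ⟪ψ Y, r Y⟫_ℝ) (cellN N L) volume :=
      hiD.neg.add hiV
    have i2 : IntegrableOn (fun Y => E * ⟪ψ Y, r Y⟫_ℝ) (cellN N L) volume := hiP.const_mul E
    have i3 : IntegrableOn (fun Y => -⟪D Y, r Y⟫_ℝ) (cellN N L) volume := hiD.neg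
    rw [integral_sub i1 i2, integral_add i3 hiV, integral_neg, integral_const_mul, ← hibp',
      ← integral_add hiK hiV, hweak']
    ring
  have hl : ∫⁻ Y in cellN N L, ((‖r Y‖₊ : ℝ≥0∞)) ^ 2 = 0 := by
    rw [lintegral_cellN_nnnorm_sq_eq_ofReal_integral hr1.continuous, hkey, ENNReal.ofReal_zero]
  have hr0 := hrp.eq_zero_of_lintegral_normSq_eq_zero hL hr1.continuous hl X
  have h : -D X + (V X : ℂ) * ψ X - (E : ℂ) * ψ X = 0 := by
    simpa only [hrdef, Complex.real_smul] using hr0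
  exact sub_eq_zero.1 h


end PuffFloorEulerLagrange

/-- **S4a `stub_eulerLagrange`: the Euler–Lagrange (eigenvalue) equation of a `C³` exact minimiser,
pointwise.** For a finite, finite-range (`R₀`) pair profile `v` with `x ↦ v(|x|)` of class `C²`, on
the torus of side `L > 2R₀` (nearest-image regime, so that `V = ∑_{i<j} v^per(xᵢ - xⱼ)` is a finite
`C²` function of the configuration, `contDiff_toReal_periodicInteraction`), every exact minimiser
`Ψ ∈ C³` of the periodic `(n+1)`-body energy with finite energy satisfies
`-ΔΨ(X) + V(X)Ψ(X) = E₀Ψ(X)` at every configuration `X`, `E₀ = periodicGroundStateEnergy v (n+1) L`,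
`ΔΨ = ∑ᵢ ∑ₐ ∂_{i,a}∂_{i,a}Ψ`. Specialisation of `PuffFloorEulerLagrange.eulerLagrange_pointwise`.
Sources: Reed–Simon IV §XIII.12; LSSY2005 Ch. 2 (2.1). -/
theorem stub_eulerLagrange :
    ∀ v : ℝ → ℝ≥0∞, IsRepulsiveFiniteRange v → (∀ r, v r ≠ ⊤) →
      ContDiff ℝ 2 (fun x : Space => (v ‖x‖).toReal) →
      ∀ R₀ : ℝ, 0 < R₀ → (∀ r, R₀ < r → v r = 0) →
      ∀ n : ℕ, ∀ L : ℝ, 0 < L → 2 * R₀ < L → ∀ Ψ : PeriodicTrialState (n + 1) L, ContDiff ℝ 3 Ψ.ψ →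
        periodicEnergy v Ψ = periodicGroundStateEnergy v (n + 1) L → periodicEnergy v Ψ ≠ ⊤ →
        ∀ X : Config (n + 1),
          -(∑ i : Fin (n + 1), ∑ a : Fin 3,
              fderiv ℝ (fun Y : Config (n + 1) =>
                  fderiv ℝ Ψ.ψ Y (Pi.single i (EuclideanSpace.single a (1 : ℝ)))) X
                (Pi.single i (EuclideanSpace.single a (1 : ℝ)))) +
            ((periodicInteraction v L X).toReal : ℂ) * Ψ.ψ X =
          ((periodicGroundStateEnergy v (n + 1) L).toReal : ℂ) * Ψ.ψ X := by
  intro v _hv hfin hC2 R₀ _hR₀ hrange n L hL h2R Ψ hC3 hmin hfinE X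
  have hW : ∀ Y : Config (n + 1), periodicInteraction v L Y =
      ENNReal.ofReal (periodicInteraction v L Y).toReal :=
    periodicInteraction_eq_ofReal_toReal hrange h2R hL hfin
  have hV : ContDiff ℝ 1 (fun Y : Config (n + 1) => (periodicInteraction v L Y).toReal) :=
    contDiff_toReal_periodicInteraction hrange h2R hL hfin (hC2.of_le (by norm_num))
  exact PuffFloorEulerLagrange.eulerLagrange_pointwise hL hV (fun _ => ENNReal.toReal_nonneg) hW Ψ
    hC3 hmin hfinE X

end Summit.AtomisticToContinuum.BoseEinsteinCondensation.Theorems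

end
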